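import Literature.Computability.Complexity.OrbitDeciders
import Literature.Computability.Complexity.PolyExistsEnumeration
import HarnessLib

/-!
# Orbit deciders, II: closure under polynomially bounded existential quantification (`∃ᵖ`)

Sequel of `OrbitDeciders.lean` (G0: a language with an `OrbitDecider` is in `PSPACE`; G1: pull-back
along Karp reductions). Here **G2**: from an orbit decider `D` of `A` and a polynomial `p` we build an
orbit decider of

  `∃ᵖ·A = {x | ∃ y, |y| ≤ p(|x|) ∧ ⟨x, y⟩ ∈ A}`

(the tree's certificate operator `polyExists`, `Nondeterministic.lean`, with `NP = polyExists P`). This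
is the textbook argument "`NP ⊆ PSPACE`: run through all certificates `y` in turn, reusing the space of
one verification" (Homer–Selman 2011, Thm. 5.10 / Cor. 5.7; Arora–Barak 2009, §4.1; in the tree the
same loop for the MAJORITY quantifier is `MajorityEnumeration.lean`, Gill's `PP ⊆ PSPACE`), with the
verification itself an exponentially long orbit: the outer loop enumerates the strings of length
`≤ p(|x|)` in shortlex order — the enumeration `PolyExistsEnum.cand k = next^[k] []` of
`PolyExistsEnumeration.lean` (little-endian successor, growing by one bit on carry-out; here realised
as the string function `sxFn`) —, and for each `y` restarts the inner orbit on `⟨x, y⟩` and runs it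
for exactly `2^{|Nu ⟨x,y⟩|}` rounds with a binary counter, OR-ing the verdicts into the answer bit.

* `OrbitDecider.polyExists D p : OrbitDecider {x | ∃ y, |y| ≤ p(|x|) ∧ boolPair x y ∈ A}`;
* `mem_PSPACE_polyExists_of_orbitDecider` — hence that language is in `PSPACE` (G0).

With the `PSPACE`-complete language of `SpaceTMSATHard.lean` this discharges the named fact
`polyExists_PSPACE_subset_PSPACE` (F2 of `SpaceOracles.lean`) in the assembly file
(`SpaceOraclesProofs.lean`). `PolyExistsEnumeration.lean` runs the same enumeration against a query
TRANSDUCER (a machine answering `⟨x, y⟩ ∈ L'` in place); the present file stays inside the `FP`-orbit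
world of `OrbitDeciders.lean`, which is what `OrbitDecidersOracle.nest` composes with.

Naming: inside `namespace OrbitDecider` the name `polyExists` denotes the closure operation
`OrbitDecider.polyExists` built here and shadows the class operator
`Literature.Computability.Complexity.polyExists` of `Nondeterministic.lean`; files that
`open OrbitDecider` should refer to the class operator by its full name.

## References

* S. Homer, A. L. Selman, *Computability and Complexity Theory*, 2nd ed., Springer 2011, Thm. 5.10
  (`NTIME(T) ⊆ DSPACE(T)`: breadth-first through the choice strings in the space of one run),
  Cor. 5.7 (`NP ⊆ PSPACE`), proof of Prop. 7.5 [HomerSelman2011].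
* S. Arora, B. Barak, *Computational Complexity: A Modern Approach*, CUP 2009, §4.1 (reuse of space),
  Thm. 4.2 [AroraBarakCC2009].
-/

noncomputable section

namespace Literature.Computability.Complexity

open _root_.Computability Polynomial Brick CoinEnum
open PolyExistsEnum (next cand cand_succ length_next cand_two_pow_add exists_cand_eq)

namespace OrbitDecider

variable {A : Language Bool}

namespace Exists

/-! ### The shortlex enumeration of all strings (`PolyExistsEnum.cand`) -/

/-- The successor `PolyExistsEnum.next` lengthens by at most one. [folklore] -/
theorem length_next_le (y : List Bool) : (next y).length ≤ y.length + 1 := by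
  rw [length_next]; split_ifs <;> omega

/-- The successor never shortens. [folklore] -/
theorem length_le_length_next (y : List Bool) : y.length ≤ (next y).length := by
  rw [length_next]; split_ifs <;> omega

/-- Lengths along the enumeration `cand` are monotone. [folklore] -/
theorem length_cand_mono {k k' : ℕ} (h : k ≤ k') : (cand k).length ≤ (cand k').length := by
  induction h with
  | refl => exact le_rfl
  | step _ ih => exact ih.trans (by rw [cand_succ]; exact length_le_length_next _)

/-- **Before index `2^{m+1} - 1` all candidates have length `≤ m`.** [folklore] -/
theorem length_cand_le {m k : ℕ} (hk : k < 2 ^ (m + 1) - 1) : (cand k).length ≤ m := by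
  have h2 : 2 ^ (m + 1) - 1 = (2 ^ m - 1 + (2 ^ m - 1)) + 1 := by
    have := Nat.one_le_two_pow (n := m); rw [pow_succ]; omega
  have hlast : (cand (2 ^ m - 1 + (2 ^ m - 1))).length = m := by
    rw [cand_two_pow_add m (2 ^ m - 1) (Nat.sub_lt (Nat.two_pow_pos m) Nat.one_pos), length_natBits]
  exact (length_cand_mono (by omega)).trans hlast.le

/-- **At index `2^{m+1} - 1` the length `m + 1` is reached.** [folklore] -/
theorem length_cand_last (m : ℕ) : (cand (2 ^ (m + 1) - 1)).length = m + 1 := by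
  have := cand_two_pow_add (m + 1) 0 (Nat.two_pow_pos _)
  rw [Nat.add_zero] at this
  rw [this, length_natBits]

/-- **Every string of length `≤ m` is a candidate of index `< 2^{m+1} - 1`** (from
`PolyExistsEnum.exists_cand_eq`). [folklore] -/
theorem exists_cand_eq_of_length_le {m : ℕ} {y : List Bool} (hy : y.length ≤ m) :
    ∃ k < 2 ^ (m + 1) - 1, cand k = y := by
  obtain ⟨k, hk, hky⟩ := exists_cand_eq y
  refine ⟨k, ?_, hky⟩
  have h2 : 2 ^ (y.length + 1) ≤ 2 ^ (m + 1) := Nat.pow_le_pow_right (by norm_num) (by omega)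
  have h3 : 1 ≤ 2 ^ y.length := Nat.one_le_two_pow
  have h4 : 2 ^ (y.length + 1) = 2 * 2 ^ y.length := by rw [pow_succ, Nat.mul_comm]
  omega

/-! ### States -/

/-- The state `a ⟨x, ⟨y, ⟨c, st⟩⟩⟩`: answer bit so far, input, current certificate, binary round counter,
current state of the inner orbit. [cite: HomerSelman2011, Thm. 5.10 (proof: tape k+1 holds the current choice string)] -/
def mk (a : Bool) (x y c st : List Bool) : List Bool :=
  a :: boolPair x (boolPair y (boolPair c st))

/-- Length of a state. [folklore] -/
theorem length_mk (a : Bool) (x y c st : List Bool) :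
    (mk a x y c st).length = 2 * x.length + 2 * y.length + 2 * c.length + st.length + 7 := by
  simp only [mk, length_boolPair, List.length_cons]; ring

/-- The head symbol of a state is its answer bit. [folklore] -/
@[simp] theorem headI_mk (a : Bool) (x y c st : List Bool) : (mk a x y c st).headI = a := rfl
/-- The flag of a state. [folklore] -/
@[simp] theorem take1Fn_mk (a : Bool) (x y c st : List Bool) : take1Fn (mk a x y c st) = [a] := rfl

/-- Accessor: the input. [folklore] -/
def xE : List Bool → List Bool := fstF ∘ List.tail
/-- Accessor: the certificate. [folklore] -/
def yE : List Bool → List Bool := nthF 1 ∘ List.tail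
/-- Accessor: the counter. [folklore] -/
def cE : List Bool → List Bool := nthF 2 ∘ List.tail
/-- Accessor: the inner state. [folklore] -/
def stE : List Bool → List Bool := sndPow 2 ∘ List.tail
/-- Accessor: the pair `⟨x, y⟩`. [folklore] -/
def xyE : List Bool → List Bool := fanoutFn xE yE

/-- `xE` on a state. [folklore] -/
@[simp] theorem xE_mk (a : Bool) (x y c st : List Bool) : xE (mk a x y c st) = x := by simp [xE, mk]
/-- `yE` on a state. [folklore] -/
@[simp] theorem yE_mk (a : Bool) (x y c st : List Bool) : yE (mk a x y c st) = y := by simp [yE, mk]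
/-- `cE` on a state. [folklore] -/
@[simp] theorem cE_mk (a : Bool) (x y c st : List Bool) : cE (mk a x y c st) = c := by simp [cE, mk]
/-- `stE` on a state. [folklore] -/
@[simp] theorem stE_mk (a : Bool) (x y c st : List Bool) : stE (mk a x y c st) = st := by simp [stE, mk]
/-- `xyE` on a state. [folklore] -/
@[simp] theorem xyE_mk (a : Bool) (x y c st : List Bool) : xyE (mk a x y c st) = boolPair x y := by
  simp [xyE]

/-- `xE ∈ FP`. [folklore] -/
theorem xE_mem_FP : xE ∈ FP := comp_mem_FP fstF_mem_FP PRelSigma.tail_mem_FP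
/-- `yE ∈ FP`. [folklore] -/
theorem yE_mem_FP : yE ∈ FP := comp_mem_FP (nthF_mem_FP 1) PRelSigma.tail_mem_FP
/-- `cE ∈ FP`. [folklore] -/
theorem cE_mem_FP : cE ∈ FP := comp_mem_FP (nthF_mem_FP 2) PRelSigma.tail_mem_FP
/-- `stE ∈ FP`. [folklore] -/
theorem stE_mem_FP : stE ∈ FP := comp_mem_FP (sndPow_mem_FP 2) PRelSigma.tail_mem_FP
/-- `xyE ∈ FP`. [folklore] -/
theorem xyE_mem_FP : xyE ∈ FP := fanoutFn_mem_FP xE_mem_FP yE_mem_FP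

/-! ### The round function -/

section Round

variable (D : OrbitDecider A) (p : Polynomial ℕ)

/-- The successor `PolyExistsEnum.next` as a string function: on carry-out the zero string of the
next length, else the little-endian increment. [folklore] -/
def sxFn : List Bool → List Bool := iteFn carryFn (List.cons false ∘ Kannan.zerosFn) incFn

/-- `sxFn = PolyExistsEnum.next`. [folklore] -/
@[simp] theorem sxFn_apply (y : List Bool) : sxFn y = next y := by
  unfold sxFn next
  cases h : TokConv.co true y
  · rw [iteFn_apply_false (by rw [carryFn_apply, h]), incFn_apply, if_neg (by simp)]
  · rw [iteFn_apply_true (by rw [carryFn_apply, h]), Function.comp_apply, Kannan.zerosFn_apply,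
      if_pos rfl, List.replicate_succ]

/-- `sxFn ∈ FP`. [folklore] -/
theorem sxFn_mem_FP : sxFn ∈ FP :=
  iteFn_mem_FP carryFn_mem_FP (comp_mem_FP (cons_mem_FP false) Kannan.zerosFn_mem_FP) incFn_mem_FP

/-- **Inner round**: step the inner orbit and the counter, `a ⟨x,y,c,st⟩ ↦ a ⟨x,y,c+1,F st⟩`. [folklore] -/
def innerStep : List Bool → List Bool := fun w =>
  take1Fn w ++ fanoutFn xE (fanoutFn yE (fanoutFn (addFn ∘ fanoutFn cE (fun _ => [true])) (D.F ∘ stE))) w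

/-- **Next certificate**: OR the verdict into the answer bit, move to the next string, restart the
inner orbit: `a ⟨x,y,c,st⟩ ↦ (a ∨ head st) ⟨x, next y, ε, ι ⟨x, next y⟩⟩`.
[cite: HomerSelman2011, Thm. 5.10 (proof, step 4: replace the choice string by the next one and restart)] -/
def nextStep : List Bool → List Bool := fun w =>
  iteFn take1Fn (fun _ => [true]) (headBitFn stE) w ++
    fanoutFn xE (fanoutFn (sxFn ∘ yE) (fanoutFn (fun _ => []) (D.ι ∘ fanoutFn xE (sxFn ∘ yE)))) w

/-- **The round function**: idle once `|y| > p(|x|)`; otherwise an inner round while the counter is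
below `2^{|Nu ⟨x,y⟩|}` (length test `|c| ≤ |Nu ⟨x,y⟩|`), else the next certificate.
[cite: HomerSelman2011, Thm. 5.10 (proof)] -/
def roundE : List Bool → List Bool :=
  iteFn (lenLeFn p ∘ xyE)
    (iteFn (lenLeFn X ∘ fanoutFn (D.Nu ∘ xyE) cE) (innerStep D) (nextStep D)) id

/-- **The initial state** `0 ⟨x, ⟨ε, ⟨ε, ι ⟨x, ε⟩⟩⟩⟩`. [folklore] -/
def initE : List Bool → List Bool :=
  List.cons false ∘ fanoutFn id (fanoutFn (fun _ => []) (fanoutFn (fun _ => []) (D.ι ∘ fanoutFn id (fun _ => []))))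

/-- **The budget exponent**: `1^{m + s(2n+2+m) + 2}` for `m = p(n)` (enough rounds for `2^{m+1}`
certificates of `≤ 2^{s(|⟨x,y⟩|)} + 1` rounds each). [folklore] -/
def NuE : List Bool → List Bool := Plumb.polyFn (p + D.s.comp (2 * X + 2 + p) + 2)

/-- `innerStep` on a state. [folklore] -/
theorem innerStep_mk (a : Bool) (x y c st : List Bool) :
    innerStep D (mk a x y c st) = mk a x y (encodeNat (bitsToNat c + 1)) (D.F st) := by
  rw [innerStep, take1Fn_mk]
  simp only [fanoutFn_apply, xE_mk, yE_mk, cE_mk, stE_mk, Function.comp_apply, addFn_boolPair,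
    show bitsToNat [true] = 1 from rfl]
  rfl

/-- `nextStep` on a state. [folklore] -/
theorem nextStep_mk (a : Bool) (x y c st : List Bool) :
    nextStep D (mk a x y c st) = mk (a || st.headI) x (next y) [] (D.ι (boolPair x (next y))) := by
  have h1 : iteFn take1Fn (fun _ => [true]) (headBitFn stE) (mk a x y c st) = [a || st.headI] := by
    cases a
    · rw [iteFn_apply_false (take1Fn_mk _ _ _ _ _), headBitFn_apply, stE_mk, Bool.false_or]
    · rw [iteFn_apply_true (take1Fn_mk _ _ _ _ _), Bool.true_or]
  rw [nextStep, h1]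
  simp only [fanoutFn_apply, xE_mk, yE_mk, Function.comp_apply, sxFn_apply]
  rfl

/-- `initE` on an input. [folklore] -/
theorem initE_apply (x : List Bool) : initE D x = mk false x [] [] (D.ι (boolPair x [])) := by
  simp only [initE, Function.comp_apply, fanoutFn_apply, id]
  rfl

/-- The round on a state whose certificate is too long: nothing happens. [folklore] -/
theorem roundE_mk_of_lt (a : Bool) (x y c st : List Bool) (hy : p.eval x.length < y.length) :
    roundE D p (mk a x y c st) = mk a x y c st := by
  rw [roundE, iteFn_apply_false (by
    rw [Function.comp_apply, xyE_mk, lenLeFn_boolPair, decide_eq_false (Nat.not_le.2 hy)])]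
  rfl

/-- The round on a state with a live certificate and a small counter: an inner round. [folklore] -/
theorem roundE_mk_inner (a : Bool) (x y c st : List Bool) (hy : y.length ≤ p.eval x.length)
    (hc : c.length ≤ (D.Nu (boolPair x y)).length) :
    roundE D p (mk a x y c st) = mk a x y (encodeNat (bitsToNat c + 1)) (D.F st) := by
  rw [roundE, iteFn_apply_true (by rw [Function.comp_apply, xyE_mk, lenLeFn_boolPair, decide_eq_true hy]),
    iteFn_apply_true (by
      rw [Function.comp_apply, fanoutFn_apply, Function.comp_apply, xyE_mk, cE_mk, lenLeFn_boolPair, eval_X,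
        decide_eq_true hc]),
    innerStep_mk]

/-- The round on a state with a live certificate and a full counter: the next certificate. [folklore] -/
theorem roundE_mk_next (a : Bool) (x y c st : List Bool) (hy : y.length ≤ p.eval x.length)
    (hc : (D.Nu (boolPair x y)).length < c.length) :
    roundE D p (mk a x y c st) = mk (a || st.headI) x (next y) [] (D.ι (boolPair x (next y))) := by
  rw [roundE, iteFn_apply_true (by rw [Function.comp_apply, xyE_mk, lenLeFn_boolPair, decide_eq_true hy]),
    iteFn_apply_false (by
      rw [Function.comp_apply, fanoutFn_apply, Function.comp_apply, xyE_mk, cE_mk, lenLeFn_boolPair, eval_X,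
        decide_eq_false (Nat.not_le.2 hc)]),
    nextStep_mk]

/-- `innerStep ∈ FP`. [cite: AroraBarakCC2009, §1.3] -/
theorem innerStep_mem_FP : innerStep D ∈ FP :=
  append_mem_FP take1Fn_mem_FP (fanoutFn_mem_FP xE_mem_FP (fanoutFn_mem_FP yE_mem_FP
    (fanoutFn_mem_FP (comp_mem_FP addFn_mem_FP (fanoutFn_mem_FP cE_mem_FP (const_mem_FP _)))
      (comp_mem_FP D.F_mem stE_mem_FP))))

/-- `nextStep ∈ FP`. [cite: AroraBarakCC2009, §1.3] -/
theorem nextStep_mem_FP : nextStep D ∈ FP :=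
  append_mem_FP (iteFn_mem_FP take1Fn_mem_FP (const_mem_FP _) (headBitFn_mem_FP stE_mem_FP))
    (fanoutFn_mem_FP xE_mem_FP (fanoutFn_mem_FP (comp_mem_FP sxFn_mem_FP yE_mem_FP)
      (fanoutFn_mem_FP (const_mem_FP _) (comp_mem_FP D.ι_mem (fanoutFn_mem_FP xE_mem_FP
        (comp_mem_FP sxFn_mem_FP yE_mem_FP))))))

/-- `roundE ∈ FP`. [cite: AroraBarakCC2009, §1.3] -/
theorem roundE_mem_FP : roundE D p ∈ FP :=
  iteFn_mem_FP (comp_mem_FP (lenLeFn_mem_FP p) xyE_mem_FP)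
    (iteFn_mem_FP (comp_mem_FP (lenLeFn_mem_FP X) (fanoutFn_mem_FP (comp_mem_FP D.Nu_mem xyE_mem_FP) cE_mem_FP))
      (innerStep_mem_FP D) (nextStep_mem_FP D))
    OracleCompose.id_mem_FP

/-- `initE ∈ FP`. [cite: AroraBarakCC2009, §1.3] -/
theorem initE_mem_FP : initE D ∈ FP :=
  comp_mem_FP (cons_mem_FP false) (fanoutFn_mem_FP OracleCompose.id_mem_FP (fanoutFn_mem_FP (const_mem_FP _)
    (fanoutFn_mem_FP (const_mem_FP _) (comp_mem_FP D.ι_mem (fanoutFn_mem_FP OracleCompose.id_mem_FP (const_mem_FP _))))))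

/-- `NuE ∈ FP`. [cite: AroraBarakCC2009, §1.3] -/
theorem NuE_mem_FP : NuE D p ∈ FP := Plumb.polyFn_mem_FP _

/-! ### The trajectory -/

/-- The exponent of the number of inner rounds for certificate `y`. [folklore] -/
def N (x y : List Bool) : ℕ := (D.Nu (boolPair x y)).length

/-- The verdict of the inner orbit on `⟨x, y⟩`. [folklore] -/
def v (x y : List Bool) : Bool := (D.F^[2 ^ N D x y] (D.ι (boolPair x y))).headI

/-- The verdict is membership in `A`. [folklore] -/
theorem v_eq_true_iff (x y : List Bool) : v D x y = true ↔ boolPair x y ∈ A := D.correct _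

/-- **Inner phase**: from the start of certificate `y` (live), `r ≤ 2^{N}` rounds advance the inner
orbit and the counter exactly. [cite: HomerSelman2011, Thm. 5.10 (proof, step 3)] -/
theorem iterate_roundE_inner (a : Bool) (x y : List Bool) (hy : y.length ≤ p.eval x.length) {r : ℕ}
    (hr : r ≤ 2 ^ N D x y) :
    (roundE D p)^[r] (mk a x y [] (D.ι (boolPair x y))) = mk a x y (encodeNat r) (D.F^[r] (D.ι (boolPair x y))) := by
  induction r with
  | zero => rfl
  | succ r ih =>
    rw [Function.iterate_succ_apply', ih (Nat.le_of_succ_le hr), roundE_mk_inner D p a x y _ _ hy (by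
      rw [TM2Pass.length_encodeNat_eq_size, Nat.size_le]; exact hr), bitsToNat_encodeNat,
      Function.iterate_succ_apply']

/-- **Phase transition**: after the inner phase one more round moves to the next certificate, OR-ing
the verdict. [cite: HomerSelman2011, Thm. 5.10 (proof, step 4)] -/
theorem iterate_roundE_phase (a : Bool) (x y : List Bool) (hy : y.length ≤ p.eval x.length) :
    (roundE D p)^[2 ^ N D x y + 1] (mk a x y [] (D.ι (boolPair x y))) =
      mk (a || v D x y) x (next y) [] (D.ι (boolPair x (next y))) := by
  rw [Function.iterate_succ_apply', iterate_roundE_inner D p a x y hy le_rfl, roundE_mk_next D p _ x y _ _ hy (by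
    rw [TM2Pass.length_encodeNat_eq_size, Nat.lt_size]; rfl)]
  rfl

/-- The start time of certificate number `k`. [folklore] -/
def S (x : List Bool) (k : ℕ) : ℕ := ∑ k' ∈ Finset.range k, (2 ^ N D x (cand k') + 1)

/-- The answer bit after `k` certificates. [folklore] -/
def acc (x : List Bool) (k : ℕ) : Bool := (List.range k).any fun k' => v D x (cand k')

/-- **The outer trajectory**: at the start of certificate `k ≤ 2^{m+1} - 1` the state holds the OR of
the earlier verdicts, the `k`-th string, a zero counter and a fresh inner orbit.
[cite: HomerSelman2011, Thm. 5.10 (proof)] -/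
theorem iterate_roundE_S (x : List Bool) {k : ℕ} (hk : k ≤ 2 ^ (p.eval x.length + 1) - 1) :
    (roundE D p)^[S D x k] (initE D x) = mk (acc D x k) x (cand k) [] (D.ι (boolPair x (cand k))) := by
  induction k with
  | zero => rw [S, Finset.sum_range_zero, Function.iterate_zero, id, initE_apply]; rfl
  | succ k ih =>
    rw [S, Finset.sum_range_succ, ← S, Nat.add_comm, Function.iterate_add_apply, ih (Nat.le_of_succ_le hk),
      iterate_roundE_phase D p _ x _ (length_cand_le hk), cand_succ]
    congr 1
    rw [acc, acc, List.range_succ, List.any_append, List.any_cons, List.any_nil, Bool.or_false]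

/-- After the last certificate the state is frozen. [folklore] -/
theorem iterate_roundE_frozen (x : List Bool) (t : ℕ) :
    (roundE D p)^[t] (mk (acc D x (2 ^ (p.eval x.length + 1) - 1)) x (cand (2 ^ (p.eval x.length + 1) - 1)) []
        (D.ι (boolPair x (cand (2 ^ (p.eval x.length + 1) - 1))))) =
      mk (acc D x (2 ^ (p.eval x.length + 1) - 1)) x (cand (2 ^ (p.eval x.length + 1) - 1)) []
        (D.ι (boolPair x (cand (2 ^ (p.eval x.length + 1) - 1)))) := by
  induction t with
  | zero => rfl
  | succ t ih => rw [Function.iterate_succ_apply', ih, roundE_mk_of_lt D p _ x _ _ _ (by rw [length_cand_last]; omega)]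

/-- **The total number of rounds** is at most `2^{m + s(2n+2+m) + 2}`. [folklore] -/
theorem S_last_le (x : List Bool) :
    S D x (2 ^ (p.eval x.length + 1) - 1) ≤ 2 ^ (p.eval x.length + D.s.eval (2 * x.length + 2 + p.eval x.length) + 2) := by
  set m := p.eval x.length with hm
  have hterm : ∀ k' ∈ Finset.range (2 ^ (m + 1) - 1),
      2 ^ N D x (cand k') + 1 ≤ 2 ^ (D.s.eval (2 * x.length + 2 + m) + 1) := by
    intro k' hk'
    rw [Finset.mem_range] at hk'
    have h1 : N D x (cand k') ≤ D.s.eval (2 * x.length + 2 + m) := by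
      refine (D.Nu_le _).trans (TM2Iter.eval_mono D.s ?_)
      rw [length_boolPair]; have := length_cand_le hk'; omega
    have h2 := Nat.pow_le_pow_right (show 0 < 2 by norm_num) h1
    have h3 := Nat.one_le_two_pow (n := D.s.eval (2 * x.length + 2 + m))
    rw [pow_succ]; omega
  refine (Finset.sum_le_sum hterm).trans ?_
  rw [Finset.sum_const, Finset.card_range, smul_eq_mul]
  have hK : 2 ^ (m + 1) - 1 ≤ 2 ^ (m + 1) := Nat.sub_le _ _
  calc (2 ^ (m + 1) - 1) * 2 ^ (D.s.eval (2 * x.length + 2 + m) + 1)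
      ≤ 2 ^ (m + 1) * 2 ^ (D.s.eval (2 * x.length + 2 + m) + 1) := Nat.mul_le_mul_right _ hK
    _ = 2 ^ (m + D.s.eval (2 * x.length + 2 + m) + 2) := by rw [← pow_add]; ring_nf

/-- **The final answer bit** is whether some certificate of length `≤ p(|x|)` is accepted.
[cite: HomerSelman2011, Thm. 5.10 and Cor. 5.7] -/
theorem acc_last_eq_true_iff (x : List Bool) :
    acc D x (2 ^ (p.eval x.length + 1) - 1) = true ↔ ∃ y, y.length ≤ p.eval x.length ∧ boolPair x y ∈ A := by
  rw [acc, List.any_eq_true]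
  constructor
  · rintro ⟨k, hk, hv⟩
    rw [List.mem_range] at hk
    exact ⟨cand k, length_cand_le hk, (v_eq_true_iff D x _).1 hv⟩
  · rintro ⟨y, hy, hyA⟩
    obtain ⟨k, hk, rfl⟩ := exists_cand_eq_of_length_le hy
    exact ⟨k, List.mem_range.2 hk, (v_eq_true_iff D x _).2 hyA⟩

/-! ### The shape invariant and the size of the states -/

/-- **Shape invariant**: every state reachable from `initE x` is `mk a x y (bin r) (F^[r] (ι ⟨x,y⟩))` with
`|y| ≤ p(|x|) + 1` and `r ≤ 2^{N ⟨x,y⟩}`. [folklore] -/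
def Shape (x w : List Bool) : Prop :=
  ∃ (a : Bool) (y : List Bool) (r : ℕ), w = mk a x y (encodeNat r) (D.F^[r] (D.ι (boolPair x y))) ∧
    y.length ≤ p.eval x.length + 1 ∧ r ≤ 2 ^ N D x y

/-- The initial state has the shape. [folklore] -/
theorem shape_initE (x : List Bool) : Shape D p x (initE D x) :=
  ⟨false, [], 0, by rw [initE_apply]; rfl, by simp, Nat.zero_le _⟩

/-- The round function preserves the shape. [folklore] -/
theorem shape_roundE {x w : List Bool} (h : Shape D p x w) : Shape D p x (roundE D p w) := by
  obtain ⟨a, y, r, rfl, hy, hr⟩ := h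
  by_cases hlive : y.length ≤ p.eval x.length
  · by_cases hc : (encodeNat r).length ≤ (D.Nu (boolPair x y)).length
    · refine ⟨a, y, r + 1, ?_, hy, ?_⟩
      · rw [roundE_mk_inner D p a x y _ _ hlive hc, bitsToNat_encodeNat, Function.iterate_succ_apply']
      · rw [TM2Pass.length_encodeNat_eq_size, Nat.size_le] at hc; exact hc
    · refine ⟨a || (D.F^[r] (D.ι (boolPair x y))).headI, next y, 0, ?_, (length_next_le y).trans (by omega), Nat.zero_le _⟩
      rw [roundE_mk_next D p a x y _ _ hlive (Nat.lt_of_not_le hc)]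
      rfl
  · exact ⟨a, y, r, by rw [roundE_mk_of_lt D p a x y _ _ (Nat.lt_of_not_le hlive)], hy, hr⟩

/-- Every state of the orbit has the shape. [folklore] -/
theorem shape_iterate (x : List Bool) (t : ℕ) : Shape D p x ((roundE D p)^[t] (initE D x)) := by
  induction t with
  | zero => exact shape_initE D p x
  | succ t ih => rw [Function.iterate_succ_apply']; exact shape_roundE D p ih

/-- **The space polynomial** of the `∃ᵖ` decider. [folklore] -/
def sE : Polynomial ℕ := 2 * X + 2 * p + 3 * D.s.comp (2 * X + 3 + p) + 13

/-- **Size of the orbit.** [cite: HomerSelman2011, Thm. 5.10 (proof: tapes 1 through k and k+1 use no more than T(n) cells)] -/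
theorem length_iterate_le (x : List Bool) (t : ℕ) : ((roundE D p)^[t] (initE D x)).length ≤ (sE D p).eval x.length := by
  obtain ⟨a, y, r, h, hy, hr⟩ := shape_iterate D p x t
  rw [h, length_mk, sE]
  have hxy : (boolPair x y).length ≤ 2 * x.length + 3 + p.eval x.length := by rw [length_boolPair]; omega
  have h1 : (D.F^[r] (D.ι (boolPair x y))).length ≤ D.s.eval (2 * x.length + 3 + p.eval x.length) :=
    (D.size_le _ r).trans (TM2Iter.eval_mono D.s hxy)
  have h2 : N D x y ≤ D.s.eval (2 * x.length + 3 + p.eval x.length) :=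
    (D.Nu_le _).trans (TM2Iter.eval_mono D.s hxy)
  have h3 : (encodeNat r).length ≤ N D x y + 1 := by
    rw [TM2Pass.length_encodeNat_eq_size, Nat.size_le]
    calc r ≤ 2 ^ N D x y := hr
      _ < 2 ^ (N D x y + 1) := Nat.pow_lt_pow_right (by norm_num) (Nat.lt_succ_self _)
  simp only [eval_add, eval_mul, eval_ofNat, eval_X, eval_comp]
  omega

end Round

end Exists

open Exists

/-- **G2. Orbit deciders are closed under `∃ᵖ`**: from an orbit decider of `A` and a polynomial `p`, an
orbit decider of `{x | ∃ y, |y| ≤ p(|x|) ∧ ⟨x, y⟩ ∈ A}` — enumerate the certificates in shortlex order,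
for each restart the inner orbit and run it for `2^{|Nu ⟨x,y⟩|}` rounds, OR the verdicts.
[cite: HomerSelman2011, Thm. 5.10 and Cor. 5.7 (NP ⊆ PSPACE by enumerating the choice strings in the space of one run)] -/
def polyExists (D : OrbitDecider A) (p : Polynomial ℕ) :
    OrbitDecider {x | ∃ y : List Bool, y.length ≤ p.eval x.length ∧ boolPair x y ∈ A} where
  F := roundE D p
  F_mem := roundE_mem_FP D p
  ι := initE D
  ι_mem := initE_mem_FP D
  Nu := NuE D p
  Nu_mem := NuE_mem_FP D p
  s := sE D p
  Nu_le x := by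
    rw [NuE, Plumb.polyFn_apply, ones, List.length_replicate, sE]
    simp only [eval_add, eval_mul, eval_ofNat, eval_X, eval_comp]
    have := TM2Iter.eval_mono D.s (show 2 * x.length + 2 + p.eval x.length ≤ 2 * x.length + 3 + p.eval x.length by omega)
    omega
  size_le := length_iterate_le D p
  correct x := by
    have hT : S D x (2 ^ (p.eval x.length + 1) - 1) ≤ 2 ^ (NuE D p x).length := by
      rw [NuE, Plumb.polyFn_apply, ones, List.length_replicate]
      simpa [eval_add, eval_comp, eval_mul] using S_last_le D p x
    obtain ⟨d, hd⟩ := Nat.exists_eq_add_of_le hT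
    rw [hd, Nat.add_comm, Function.iterate_add_apply, iterate_roundE_S D p x le_rfl, iterate_roundE_frozen,
      headI_mk]
    exact acc_last_eq_true_iff D p x

end OrbitDecider

/-- **`∃ᵖ` of an orbit-decided language is in `PSPACE`.** [cite: HomerSelman2011, Cor. 5.7 and proof of Prop. 7.5] -/
theorem mem_PSPACE_polyExists_of_orbitDecider {A : Language Bool} (D : OrbitDecider A) (p : Polynomial ℕ) :
    {x | ∃ y : List Bool, y.length ≤ p.eval x.length ∧ boolPair x y ∈ A} ∈ PSPACE :=
  (D.polyExists p).mem_PSPACE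

end Literature.Computability.Complexity
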